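import Summits.QuantumFields.BalabanUV.Beta.AveragedAFCarrierJsBalT2
import Summits.QuantumFields.BalabanUV.Beta.MixedJetTablesPlug

/-!
# BalabanUV / Beta / AveragedAFCarrierJsBalAn1 — the whole located [III] list OVER THE WALL STATEMENT v2.21,
# `D1Drift Lc (MixedJetTablesPlug.JsBalAn1 hLc hr cE cVH cΛ cE₂ cB T) N μ ν` (any box root `r`), and over its CENTRED instance `JsBalAn1Ctr`
# (pub-balaban β sub-cell, [III]-side CO-LEAD unit `b2b-balaban-strat-b14` gen 26; trigger (t1″) of MISSING-B14 §9.40 (e): an1's node-12b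
# tables PLUGGED into an2's recursive family — `MixedJetTablesPlug` v1 p195364, β-lead WALL v2.21 «NO table hypothesis remains»)

PLACEMENT.  A CELL RESULT (our own derived ENDs over our typed objects; nothing printed by Bałaban is reproduced), under the cell topic
`Summits/QuantumFields/BalabanUV/Beta/` per the β-lead's RULING (R34-A); imports two SIBLING cell-topic leaves only (this lineage's
`AveragedAFCarrierJsBalT2` p195015 and an1's `MixedJetTablesPlug` p195364).

VERSIONS
* v1 (this file; gen 26): §1 (D1) currency over `JsBalAn1 …` (any box root), §2 the literal written out (an1's `TbalOf_JsBalAn1` BY NAME),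
  §3 one Cauchy / limit-currency END, §4 the CENTRED instance `JsBalAn1Ctr` (END + carrier).  Theorems only; 0 `def`; 0 `def … : Prop`.

HONEST FRAMING (page 1 of everything the β sub-cell writes): discharging `BetaPertH` makes Bałaban's UV stability UNCONDITIONAL — a
real constructive-QFT result; it is NOT the continuum limit and NOT the Clay problem.  THIS MODULE is CLASS-LEVEL BOOKKEEPING: it
instantiates `AveragedAFCarrierJsBalT2` (the [III] list over `JsBalT2Of hLc cE cVH cΛ cE₂ cB T hB hmix`, the border tables `vh₂S`/`mixFF`
BINDERS through `hB`/`hmix`) at an1's plug — `MixedJetTablesPlug.JsBalAn1 hLc hr cE cVH cΛ cE₂ cB T := JsBalT2Of hLc cE cVH cΛ cE₂ cB T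
(hB_an1 hLc hr) (hmix_an1 hLc hr)` (definitional; `vh₂S := vh₂SAt (toSite r) Lc`, `mixFF := mixFFAt (toSite r) Lc`), and at the centred root
`JsBalAn1Ctr hLc cE cVH cΛ cE₂ cB T := JsBalAn1 hLc (ctrOff_mem_box hLc) …` (`JsBalAn1Ctr_eq`, `rfl`) — and asserts nothing printed by
Bałaban.  EVERY load-bearing β-binder below (`D1Drift`, the six (CONV-C-Cauchy) data binders, `hident`, `RemainderConst`, `BetaContH`) is a
HYPOTHESIS; for the literal `JsBalAn1 …` the binder `hD : D1Drift Lc (JsBalAn1 …) N μ ν` IS THE WALL v2.21 (EXIT-A of the cell) — nothing here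
proves it, and nothing here could: the wall is UNTOUCHED; road-(1) verdict unchanged (PRECISELY WALLED at END-STATEMENT grade; nothing of
(M2⁺)/`BetaPertH` discharged); value = census precision: the `hD` column of the [III] carrier is a closed term of the tree whose ONLY
remaining binders are `hLc : 1 ≤ Lc`, the box root `hr : r ∈ box 4 Lc` (centred: none), an3's Wilson two-bond position table `T` (by value)
and the colour / sign constants `cE cVH cΛ cE₂ cB` ((P6), pinned last) — NO table hypothesis remains — plus, inside an2's definitions BY
NAME, the PROVISIONAL UNITS numerals (P6′).  ROOT BOOK-KEEPING (lead, WALL v2.21): `JsBalAn1Ctr` centres the SECOND-order borders only;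
the coherent centred literal (an2's (P7′) ρ-threading) is a later wall version and NOT this file's object.  NOT summit progress.

ABSOLUTE RULE (cell charter, verbatim): "No internally-minted statement may enter as a cited fact. Every hypothesis is either
kernel-proved in this package or a verbatim quotation of a PUBLISHED theorem with page reference. The manuscript(s) under audit are
NOT citable for their own disputed steps — they are the thing under adjudication; programme-internal (2001/route/tribunal) claims
are never citable."

NON-VACUITY.  Abstract lists inhabited (lead `Beta.WallWitness`, `StepDriftWitness`, `AveragedAFCarrierAllScales` §5); for the literal the
inhabitation of `hD` / `hident` / the (CONV-C-Cauchy) rows IS the open wall and the sub-cell's open supplier rows — no witness offered or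
possible, by design; the theorems are implications.  READING CLAUSE (W-KKT-2) as in the JsBal leaves: the identification of the `μ ≠ ν`
second moment of `TbalOf Lc (JsBalAn1 …) j` with Bałaban's printed (1.22) coefficient is the sub-cell's READING — NOT asserted here.  The
other currency forms (named-limit, road B, census form, flowIneq/t4FlowInputs at the centred root) apply BY NAME; not re-typed (400-l. cap).
-/

noncomputable section

namespace Summit.QuantumFields.BalabanUV.Beta.AveragedAFCarrierJsBalAn1

open Finset
open Literature.MathematicalPhysics.QuantumFieldTheory.Balaban1983to89
open Literature.MathematicalPhysics.QuantumFieldTheory.Balaban1983to89.Beta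
open Literature.MathematicalPhysics.QuantumFieldTheory.Balaban1983to89.Beta.AffineAveraging
open Literature.MathematicalPhysics.QuantumFieldTheory.Balaban1983to89.Beta.AveragingContoursRooted
open Literature.MathematicalPhysics.QuantumFieldTheory.Balaban1983to89.Beta.AveragingMixedJetTables
open FlowStep FlowStepRuns DagBinding B14DeltaBeta
open Literature.MathematicalPhysics.QuantumFieldTheory.Balaban1983to89.Beta.Drift (OneLoopDrift)
open Literature.MathematicalPhysics.QuantumFieldTheory.Balaban1983to89.Beta.RemainderChain (RemainderConst)
open Literature.MathematicalPhysics.QuantumFieldTheory.Balaban1983to89.Beta.OneStepResolventKernel (Fib LocStencil JetData)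
open Literature.MathematicalPhysics.QuantumFieldTheory.Balaban1983to89.Beta.OneStepKernelFamily (KInvStep TbalOf D1Drift)
open Literature.MathematicalPhysics.QuantumFieldTheory.Balaban1983to89.Beta.AxialDressing (axDressK axVertexOfK)
open Literature.MathematicalPhysics.QuantumFieldTheory.Balaban1983to89.Beta.BalabanStepJetsSucc (JsBal0Of)
open Literature.MathematicalPhysics.QuantumFieldTheory.Balaban1983to89.Beta.BalabanStepW2
  (WbalOf CwOf δwOf δwOf_pos WbalOf_loc₂ T2Of T2Of_loc WbalT2Of JsBalT2Of)
open Literature.MathematicalPhysics.QuantumFieldTheory.Balaban1983to89.B12Beta (secondMoment)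
open ExpKernelCalculus (MKer Decays VertexFamily₂ hessKer)
open Literature.MathematicalPhysics.QuantumFieldTheory.Balaban1983to89.Beta.HessKerDressedLimit (limMKerOf limStOf limTabOf)
open Literature.MathematicalPhysics.QuantumFieldTheory.Balaban1983to89.Beta.AveragedAFCarrier (BetaAvgAFH)
open Summit.QuantumFields.BalabanUV.Beta.MixedJetTablesPlug (hB_an1 hmix_an1 JsBalAn1 TbalOf_JsBalAn1 JsBalAn1Ctr)
open Summit.QuantumFields.BalabanUV.Beta.AveragedAFCarrierJsBalT2

variable {β : HBeta} {Lc : ℕ} [NeZero Lc] {r : Fin (3 + 1) → ℕ}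
  (hLc : 1 ≤ Lc) (hr : r ∈ box (3 + 1) Lc) (cE cVH cΛ cE₂ cB : ℝ) (T : Fin 4 → Fin 4 → Fin 4 → Fin 4 → ℝ)

/-! ## §1 (D1) currency: WALL v2.21's literal `D1Drift Lc (JsBalAn1 hLc hr …) N μ ν` ⟹ the whole located [III] list (any box root) -/

section StatementForm

/-- **THE WHOLE LOCATED [III] LIST OVER THE WALL STATEMENT v2.21, ALL PROFILES** — `AveragedAFCarrierJsBalT2.wallEND_of_D1Drift_JsBalT2Of_cont_allProfiles`
at `hB := hB_an1 hLc hr`, `hmix := hmix_an1 hLc hr` (an1's `JsBalAn1`, definitional): binders = the literal's own (`hLc`, the box root `hr`, colours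
`cE cVH cΛ cE₂ cB`, an3's table `T`) + `ForwardGenerated`, the split `S` with `hβ`, **THE WALL `hD : D1Drift Lc (JsBalAn1 hLc hr cE cVH cΛ cE₂ cB T) N μ ν`**,
**(D4) STRICT**, **(C)**, `0 < γ₀`, run-side ⟹ `EndpointExistence Cn ∧ ∃ A, ∃ γ₁ > 0, …, sizes ∧ HorizonFacts`, `β′ := stepBal N Lc + 2A + r'`.  NO table
hypothesis among the binders.  Discharges nothing of `BetaPertH` (`hD` is the wall).  Our own derived statement. -/
theorem wallEND_of_D1Drift_JsBalAn1_cont_allProfiles {Cn : B12.Construction} (hgen : ForwardGenerated Cn β)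
    (hhalt : HaltsOutside Cn β) (hcur : CurriesHBeta Cn β) (S : B12Beta.OneLoopSplit β) {N : ℝ} {μ ν : Fin 4}
    (hβ : ∀ j, S.β0 j = secondMoment (TbalOf Lc (JsBalAn1 hLc hr cE cVH cΛ cE₂ cB T) j) μ ν)
    (hD : D1Drift Lc (JsBalAn1 hLc hr cE cVH cΛ cE₂ cB T) N μ ν) {γ₀ r' β₀ : ℝ}
    (hγ₀ : 0 < γ₀) (hrem : RemainderConst S γ₀ r') (hr' : r' < B12Normalization.stepBal N Lc) (hcont : BetaContH γ₀ β)
    (hβ₀ : 0 < β₀) {L : ℕ} (hL2 : 2 ≤ L) (p : ℕ) {κ₀ : ℕ} (hκ : 6 ≤ κ₀) :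
    EndpointExistence Cn ∧ ∃ A : ℝ, ∃ γ₁ : ℝ, 0 < γ₁ ∧
      ∀ γ : ℝ, 0 < γ → γ ≤ min γ₀ γ₁ → ∀ Pr : B12.RunParams, (Cn Pr).flow.InInterval γ Pr.K →
        ∀ p' : ℕ, p' ≤ p → ∀ A₀ : ℝ, 0 ≤ A₀ →
          ∃ Rj : ℕ → ℕ, (∀ j, B14.IsRj L p' ((Cn Pr).flow.g j) (Rj j)) ∧
            HorizonFacts (Cn Pr).flow (B12Normalization.stepBal N Lc + 2 * A + r') β₀ A₀ L p' κ₀ Rj Pr.K :=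
  wallEND_of_D1Drift_JsBalT2Of_cont_allProfiles hLc cE cVH cΛ cE₂ cB T (hB_an1 hLc hr) (hmix_an1 hLc hr) hgen hhalt hcur S hβ hD
    hγ₀ hrem hr' hcont hβ₀ hL2 p hκ

/-- **… AT `r' ≤ stepBal N Lc`, NO (C): (2.6)–(2.9) FOR ALL PROFILES** over WALL v2.21's literal
(`AveragedAFCarrierJsBalT2.flowIneq_of_D1Drift_JsBalT2Of_allProfiles` at an1's plug).  Our own derived statement. -/
theorem flowIneq_of_D1Drift_JsBalAn1_allProfiles {Cn : B12.Construction} (hgen : ForwardGenerated Cn β)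
    (hhalt : HaltsOutside Cn β) (hcur : CurriesHBeta Cn β) (S : B12Beta.OneLoopSplit β) {N : ℝ} {μ ν : Fin 4}
    (hβ : ∀ j, S.β0 j = secondMoment (TbalOf Lc (JsBalAn1 hLc hr cE cVH cΛ cE₂ cB T) j) μ ν)
    (hD : D1Drift Lc (JsBalAn1 hLc hr cE cVH cΛ cE₂ cB T) N μ ν) {γ₀ r' β₀ : ℝ}
    (hγ₀ : 0 < γ₀) (hrem : RemainderConst S γ₀ r') (hr' : r' ≤ B12Normalization.stepBal N Lc) (hβ₀ : 0 < β₀) {L : ℕ}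
    (hL2 : 2 ≤ L) (p : ℕ) :
    ∃ A : ℝ, ∃ γ₁ : ℝ, 0 < γ₁ ∧
      ∀ γ : ℝ, 0 < γ → γ ≤ min γ₀ γ₁ → ∀ Pr : B12.RunParams, (Cn Pr).flow.InInterval γ Pr.K →
        ∀ p' : ℕ, p' ≤ p → ∀ A₀ : ℝ, 0 ≤ A₀ →
          ∃ Rj : ℕ → ℕ, (∀ j, B14.IsRj L p' ((Cn Pr).flow.g j) (Rj j)) ∧
            B14.FlowIneq26 (Cn Pr).flow.g (B12Normalization.stepBal N Lc + 2 * A + r') β₀ Pr.K ∧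
            B14.FlowIneq27 (Cn Pr).flow.g (B12Normalization.stepBal N Lc + 2 * A + r') β₀ p' Pr.K ∧
            B14.FlowIneq28 (epsK A₀ p' (Cn Pr).flow) (Cn Pr).flow.g (B12Normalization.stepBal N Lc + 2 * A + r') β₀ Pr.K ∧
            B14FlowStep.FlowIneq29 Rj (Cn Pr).flow.g L (B12Normalization.stepBal N Lc + 2 * A + r') β₀ Pr.K :=
  flowIneq_of_D1Drift_JsBalT2Of_allProfiles hLc cE cVH cΛ cE₂ cB T (hB_an1 hLc hr) (hmix_an1 hLc hr) hgen hhalt hcur S hβ hD hγ₀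
    hrem hr' hβ₀ hL2 p

/-- **… AT `r' ≤ stepBal N Lc`, NO (C): THE T⁴ CELL's FLOW-FACT BINDERS (MISSING-B14 §8 C19/C20)** over WALL v2.21's literal
(`AveragedAFCarrierJsBalT2.t4FlowInputs_of_D1Drift_JsBalT2Of` at an1's plug).  Our own derived statement. -/
theorem t4FlowInputs_of_D1Drift_JsBalAn1 {Cn : B12.Construction} (hgen : ForwardGenerated Cn β)
    (hhalt : HaltsOutside Cn β) (hcur : CurriesHBeta Cn β) (S : B12Beta.OneLoopSplit β) {N : ℝ} {μ ν : Fin 4}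
    (hβ : ∀ j, S.β0 j = secondMoment (TbalOf Lc (JsBalAn1 hLc hr cE cVH cΛ cE₂ cB T) j) μ ν)
    (hD : D1Drift Lc (JsBalAn1 hLc hr cE cVH cΛ cE₂ cB T) N μ ν) {γ₀ r' β₀ : ℝ}
    (hγ₀ : 0 < γ₀) (hrem : RemainderConst S γ₀ r') (hr' : r' ≤ B12Normalization.stepBal N Lc) (hβ₀ : 0 < β₀) {L : ℕ}
    (hL2 : 2 ≤ L) {p₀ r'' : ℕ} (hr'' : r'' ≤ p₀) :
    ∃ A : ℝ, ∃ γ₁ : ℝ, 0 < γ₁ ∧ ∀ γ : ℝ, 0 < γ → γ ≤ min γ₀ γ₁ → ∀ Pr : B12.RunParams, (Cn Pr).flow.InInterval γ Pr.K →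
      B14.FlowIneq27 (Cn Pr).flow.g (B12Normalization.stepBal N Lc + 2 * A + r') β₀ p₀ Pr.K ∧
      (∀ j, j ≤ Pr.K → 1 ≤ Real.log (((Cn Pr).flow.g j) ^ 2)⁻¹) ∧
      ∃ Rj : ℕ → ℕ, (∀ j, B14.IsRj L r'' ((Cn Pr).flow.g j) (Rj j)) ∧
        B14FlowStep.FlowIneq29 Rj (Cn Pr).flow.g L (B12Normalization.stepBal N Lc + 2 * A + r') β₀ Pr.K :=
  t4FlowInputs_of_D1Drift_JsBalT2Of hLc cE cVH cΛ cE₂ cB T (hB_an1 hLc hr) (hmix_an1 hLc hr) hgen hhalt hcur S hβ hD hγ₀ hrem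
    hr' hβ₀ hL2 hr''

/-- **THE MINIMAL [III] CARRIER OVER WALL v2.21's LITERAL**: the wall + `hβ` + (D4) ⟹ `∃ A, BetaAvgAFH (stepBal N Lc − r') (2A) γ β`
(`AveragedAFCarrierJsBalT2.betaAvgAFH_of_D1Drift_JsBalT2Of` at an1's plug).  Our own derived statement. -/
theorem betaAvgAFH_of_D1Drift_JsBalAn1 (S : B12Beta.OneLoopSplit β) {N : ℝ} {μ ν : Fin 4}
    (hβ : ∀ j, S.β0 j = secondMoment (TbalOf Lc (JsBalAn1 hLc hr cE cVH cΛ cE₂ cB T) j) μ ν)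
    (hD : D1Drift Lc (JsBalAn1 hLc hr cE cVH cΛ cE₂ cB T) N μ ν) {γ r' : ℝ} (hrem : RemainderConst S γ r') :
    ∃ A : ℝ, BetaAvgAFH (B12Normalization.stepBal N Lc - r') (2 * A) γ β :=
  betaAvgAFH_of_D1Drift_JsBalT2Of hLc cE cVH cΛ cE₂ cB T (hB_an1 hLc hr) (hmix_an1 hLc hr) S hβ hD hrem

end StatementForm

/-! ## §2 WALL v2.21's literal written out (an1's `TbalOf_JsBalAn1` BY NAME: an1's tables plugged into the recursive family) -/

section ClosedForm

/-- **THE WALL STATEMENT v2.21, WRITTEN OUT** (unfolded once through `D1Drift` and `TbalOf_JsBalAn1`): `D1Drift Lc (JsBalAn1 hLc hr …) N μ ν`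
IS `∃ A, ∀ k, |Σ_{j<k} secondMoment (hessKer (axDressK Lc (KInvStep Lc j)) (axVertexOfK (KInvStep Lc j) Lc (JsBal⁰_j).S) (WbalT2Of … j)) μ ν −
stepBal N Lc · k| ≤ A` with the recursive second-order family at `vh₂S := vh₂SAt (toSite r) Lc`, `mixFF := mixFFAt (toSite r) Lc` — an1's
node-12b tables in place; NO table hypothesis left.  A restatement of the hypothesis; a standard unfolding lemma. -/
theorem d1Drift_JsBalAn1_iff {N : ℝ} {μ ν : Fin 4} :
    D1Drift Lc (JsBalAn1 hLc hr cE cVH cΛ cE₂ cB T) N μ ν ↔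
      ∃ A : ℝ, ∀ k : ℕ,
        |∑ j ∈ Finset.range k,
            secondMoment (hessKer (axDressK Lc (KInvStep (d := 3) Lc j))
              (axVertexOfK (KInvStep (d := 3) Lc j) Lc
                (JsBal0Of hLc cE cVH cΛ
                  (WbalT2Of (Lc := Lc) cE cVH cΛ cE₂ cB T (vh₂S := vh₂SAt (toSite r) Lc) (mixFF := mixFFAt (toSite r) Lc))
                  (CwOf hLc cE cVH cΛ (T2Of_loc hLc cE cVH cΛ cE₂ cB T (hB_an1 hLc hr) (hmix_an1 hLc hr)) (hmix_an1 hLc hr))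
                  (δwOf hLc cE cVH cΛ (T2Of_loc hLc cE cVH cΛ cE₂ cB T (hB_an1 hLc hr) (hmix_an1 hLc hr)) (hmix_an1 hLc hr))
                  (δwOf_pos hLc cE cVH cΛ (T2Of_loc hLc cE cVH cΛ cE₂ cB T (hB_an1 hLc hr) (hmix_an1 hLc hr)) (hmix_an1 hLc hr))
                  (WbalOf_loc₂ hLc cE cVH cΛ (T2Of_loc hLc cE cVH cΛ cE₂ cB T (hB_an1 hLc hr) (hmix_an1 hLc hr)) (hmix_an1 hLc hr))
                  j).S)
              (WbalT2Of (Lc := Lc) cE cVH cΛ cE₂ cB T (vh₂S := vh₂SAt (toSite r) Lc) (mixFF := mixFFAt (toSite r) Lc) j)) μ ν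
          - B12Normalization.stepBal N Lc * k| ≤ A := by
  have h : (fun j => secondMoment (TbalOf Lc (JsBalAn1 hLc hr cE cVH cΛ cE₂ cB T) j) μ ν)
      = fun j => secondMoment (hessKer (axDressK Lc (KInvStep (d := 3) Lc j))
          (axVertexOfK (KInvStep (d := 3) Lc j) Lc
            (JsBal0Of hLc cE cVH cΛ
              (WbalT2Of (Lc := Lc) cE cVH cΛ cE₂ cB T (vh₂S := vh₂SAt (toSite r) Lc) (mixFF := mixFFAt (toSite r) Lc))
              (CwOf hLc cE cVH cΛ (T2Of_loc hLc cE cVH cΛ cE₂ cB T (hB_an1 hLc hr) (hmix_an1 hLc hr)) (hmix_an1 hLc hr))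
              (δwOf hLc cE cVH cΛ (T2Of_loc hLc cE cVH cΛ cE₂ cB T (hB_an1 hLc hr) (hmix_an1 hLc hr)) (hmix_an1 hLc hr))
              (δwOf_pos hLc cE cVH cΛ (T2Of_loc hLc cE cVH cΛ cE₂ cB T (hB_an1 hLc hr) (hmix_an1 hLc hr)) (hmix_an1 hLc hr))
              (WbalOf_loc₂ hLc cE cVH cΛ (T2Of_loc hLc cE cVH cΛ cE₂ cB T (hB_an1 hLc hr) (hmix_an1 hLc hr)) (hmix_an1 hLc hr))
              j).S)
          (WbalT2Of (Lc := Lc) cE cVH cΛ cE₂ cB T (vh₂S := vh₂SAt (toSite r) Lc) (mixFF := mixFFAt (toSite r) Lc) j)) μ ν := by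
    funext j; rw [TbalOf_JsBalAn1]
  unfold D1Drift OneLoopDrift
  rw [h]

end ClosedForm

/-! ## §3 Cauchy / limit currency over WALL v2.21's literal (`AveragedAFCarrierJsBalT2` §3 at an1's plug) -/

section LimitCurrency

variable {R C cK δK Cs cS δS C₂ c₂ δ₂ θ : ℝ}

/-- **THE WHOLE LOCATED [III] LIST OVER WALL v2.21's LITERAL FROM (CONV-C-Cauchy) + THE EXPLICIT IDENTIFICATION AT THE CONSTRUCTED LIMITS,
ALL PROFILES** — `AveragedAFCarrierJsBalT2.wallEND_of_cauchy_eq_JsBalT2Of_cont_allProfiles` at an1's plug: the six (CONV-C-Cauchy) data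
binders with the table rows on the assembled family `WbalOf 3 Lc cE cVH cΛ (T2Of … (vh₂SAt (toSite r) Lc) (mixFFAt (toSite r) Lc)) (mixFFAt
(toSite r) Lc) j` (the `j`-UNIFORM row STAYS a binder) + `0 ≤ θ < 1` + `hident` at the constructed limits with `W∞ := limTabOf (WbalOf …)`;
then §1.  Discharges nothing of `BetaPertH` (`hident` is the wall read explicitly).  Our own derived statement. -/
theorem wallEND_of_cauchy_eq_JsBalAn1_cont_allProfiles
    (hK : ∀ j, Decays (KInvStep (d := 3) Lc j) C δK)
    (hKall : ∀ k j, Decays (KInvStep (d := 3) Lc (k + j) - KInvStep (d := 3) Lc k) (cK * θ ^ k) δK)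
    (hS : ∀ j, LocStencil (JsBal0Of hLc cE cVH cΛ
      (WbalOf 3 Lc cE cVH cΛ (T2Of 3 Lc cE cVH cΛ cE₂ cB T (vh₂SAt (toSite r) Lc) (mixFFAt (toSite r) Lc)) (mixFFAt (toSite r) Lc))
      (CwOf hLc cE cVH cΛ (T2Of_loc hLc cE cVH cΛ cE₂ cB T (hB_an1 hLc hr) (hmix_an1 hLc hr)) (hmix_an1 hLc hr))
      (δwOf hLc cE cVH cΛ (T2Of_loc hLc cE cVH cΛ cE₂ cB T (hB_an1 hLc hr) (hmix_an1 hLc hr)) (hmix_an1 hLc hr))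
      (δwOf_pos hLc cE cVH cΛ (T2Of_loc hLc cE cVH cΛ cE₂ cB T (hB_an1 hLc hr) (hmix_an1 hLc hr)) (hmix_an1 hLc hr))
      (WbalOf_loc₂ hLc cE cVH cΛ (T2Of_loc hLc cE cVH cΛ cE₂ cB T (hB_an1 hLc hr) (hmix_an1 hLc hr)) (hmix_an1 hLc hr)) j).S Cs δS)
    (hSall : ∀ k j, LocStencil
      ((JsBal0Of hLc cE cVH cΛ
          (WbalOf 3 Lc cE cVH cΛ (T2Of 3 Lc cE cVH cΛ cE₂ cB T (vh₂SAt (toSite r) Lc) (mixFFAt (toSite r) Lc)) (mixFFAt (toSite r) Lc))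
          (CwOf hLc cE cVH cΛ (T2Of_loc hLc cE cVH cΛ cE₂ cB T (hB_an1 hLc hr) (hmix_an1 hLc hr)) (hmix_an1 hLc hr))
          (δwOf hLc cE cVH cΛ (T2Of_loc hLc cE cVH cΛ cE₂ cB T (hB_an1 hLc hr) (hmix_an1 hLc hr)) (hmix_an1 hLc hr))
          (δwOf_pos hLc cE cVH cΛ (T2Of_loc hLc cE cVH cΛ cE₂ cB T (hB_an1 hLc hr) (hmix_an1 hLc hr)) (hmix_an1 hLc hr))
          (WbalOf_loc₂ hLc cE cVH cΛ (T2Of_loc hLc cE cVH cΛ cE₂ cB T (hB_an1 hLc hr) (hmix_an1 hLc hr)) (hmix_an1 hLc hr)) (k + j)).S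
        - (JsBal0Of hLc cE cVH cΛ
          (WbalOf 3 Lc cE cVH cΛ (T2Of 3 Lc cE cVH cΛ cE₂ cB T (vh₂SAt (toSite r) Lc) (mixFFAt (toSite r) Lc)) (mixFFAt (toSite r) Lc))
          (CwOf hLc cE cVH cΛ (T2Of_loc hLc cE cVH cΛ cE₂ cB T (hB_an1 hLc hr) (hmix_an1 hLc hr)) (hmix_an1 hLc hr))
          (δwOf hLc cE cVH cΛ (T2Of_loc hLc cE cVH cΛ cE₂ cB T (hB_an1 hLc hr) (hmix_an1 hLc hr)) (hmix_an1 hLc hr))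
          (δwOf_pos hLc cE cVH cΛ (T2Of_loc hLc cE cVH cΛ cE₂ cB T (hB_an1 hLc hr) (hmix_an1 hLc hr)) (hmix_an1 hLc hr))
          (WbalOf_loc₂ hLc cE cVH cΛ (T2Of_loc hLc cE cVH cΛ cE₂ cB T (hB_an1 hLc hr) (hmix_an1 hLc hr)) (hmix_an1 hLc hr)) k).S)
      (cS * θ ^ k) δS)
    (hW₂ : ∀ j, VertexFamily₂
      (WbalOf 3 Lc cE cVH cΛ (T2Of 3 Lc cE cVH cΛ cE₂ cB T (vh₂SAt (toSite r) Lc) (mixFFAt (toSite r) Lc)) (mixFFAt (toSite r) Lc) j)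
      Lc C₂ δ₂)
    (hW₂all : ∀ k j, VertexFamily₂
      (WbalOf 3 Lc cE cVH cΛ (T2Of 3 Lc cE cVH cΛ cE₂ cB T (vh₂SAt (toSite r) Lc) (mixFFAt (toSite r) Lc)) (mixFFAt (toSite r) Lc) (k + j)
        - WbalOf 3 Lc cE cVH cΛ (T2Of 3 Lc cE cVH cΛ cE₂ cB T (vh₂SAt (toSite r) Lc) (mixFFAt (toSite r) Lc)) (mixFFAt (toSite r) Lc) k)
      Lc (c₂ * θ ^ k) δ₂)
    (hR : 0 < R) (hRK : R < δK) (hRS : R / 2 < δS) (hRW : R < δ₂) (hθ0 : 0 ≤ θ) (hθ1 : θ < 1) {μ ν : Fin 4} {N : ℝ}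
    (hident : secondMoment (hessKer (axDressK Lc (limMKerOf (KInvStep (d := 3) Lc)))
        (axVertexOfK (limMKerOf (KInvStep (d := 3) Lc)) Lc (limStOf fun j =>
          (JsBal0Of hLc cE cVH cΛ
            (WbalOf 3 Lc cE cVH cΛ (T2Of 3 Lc cE cVH cΛ cE₂ cB T (vh₂SAt (toSite r) Lc) (mixFFAt (toSite r) Lc)) (mixFFAt (toSite r) Lc))
            (CwOf hLc cE cVH cΛ (T2Of_loc hLc cE cVH cΛ cE₂ cB T (hB_an1 hLc hr) (hmix_an1 hLc hr)) (hmix_an1 hLc hr))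
            (δwOf hLc cE cVH cΛ (T2Of_loc hLc cE cVH cΛ cE₂ cB T (hB_an1 hLc hr) (hmix_an1 hLc hr)) (hmix_an1 hLc hr))
            (δwOf_pos hLc cE cVH cΛ (T2Of_loc hLc cE cVH cΛ cE₂ cB T (hB_an1 hLc hr) (hmix_an1 hLc hr)) (hmix_an1 hLc hr))
            (WbalOf_loc₂ hLc cE cVH cΛ (T2Of_loc hLc cE cVH cΛ cE₂ cB T (hB_an1 hLc hr) (hmix_an1 hLc hr)) (hmix_an1 hLc hr)) j).S))
        (limTabOf (WbalOf 3 Lc cE cVH cΛ (T2Of 3 Lc cE cVH cΛ cE₂ cB T (vh₂SAt (toSite r) Lc) (mixFFAt (toSite r) Lc))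
          (mixFFAt (toSite r) Lc)))) μ ν = B12Normalization.stepBal N Lc)
    {Cn : B12.Construction} (hgen : ForwardGenerated Cn β) (hhalt : HaltsOutside Cn β) (hcur : CurriesHBeta Cn β)
    (S : B12Beta.OneLoopSplit β)
    (hβ : ∀ j, S.β0 j = secondMoment (TbalOf Lc (JsBalAn1 hLc hr cE cVH cΛ cE₂ cB T) j) μ ν) {γ₀ r' β₀ : ℝ}
    (hγ₀ : 0 < γ₀) (hrem : RemainderConst S γ₀ r') (hr' : r' < B12Normalization.stepBal N Lc) (hcont : BetaContH γ₀ β)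
    (hβ₀ : 0 < β₀) {L : ℕ} (hL2 : 2 ≤ L) (p : ℕ) {κ₀ : ℕ} (hκ : 6 ≤ κ₀) :
    EndpointExistence Cn ∧ ∃ A : ℝ, ∃ γ₁ : ℝ, 0 < γ₁ ∧
      ∀ γ : ℝ, 0 < γ → γ ≤ min γ₀ γ₁ → ∀ Pr : B12.RunParams, (Cn Pr).flow.InInterval γ Pr.K →
        ∀ p' : ℕ, p' ≤ p → ∀ A₀ : ℝ, 0 ≤ A₀ →
          ∃ Rj : ℕ → ℕ, (∀ j, B14.IsRj L p' ((Cn Pr).flow.g j) (Rj j)) ∧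
            HorizonFacts (Cn Pr).flow (B12Normalization.stepBal N Lc + 2 * A + r') β₀ A₀ L p' κ₀ Rj Pr.K :=
  wallEND_of_cauchy_eq_JsBalT2Of_cont_allProfiles hLc cE cVH cΛ cE₂ cB T (hB_an1 hLc hr) (hmix_an1 hLc hr) hK hKall hS hSall hW₂
    hW₂all hR hRK hRS hRW hθ0 hθ1 hident hgen hhalt hcur S hβ hγ₀ hrem hr' hcont hβ₀ hL2 p hκ

end LimitCurrency

/-! ## §4 The CENTRED instance `JsBalAn1Ctr hLc cE cVH cΛ cE₂ cB T` (binders: `hLc`, colours, `T` — and the wall) -/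

section Centred

variable {Lc : ℕ} [NeZero Lc] (hLc : 1 ≤ Lc) (cE cVH cΛ cE₂ cB : ℝ) (T : Fin 4 → Fin 4 → Fin 4 → Fin 4 → ℝ)

/-- **THE WHOLE LOCATED [III] LIST OVER THE CENTRED PLUGGED-IN FAMILY, ALL PROFILES** — §1 at the centred root `hr := ctrOff_mem_box hLc`
(an1's `JsBalAn1Ctr_eq`, `rfl`): binders = `hLc`, colours `cE cVH cΛ cE₂ cB`, `T` + `ForwardGenerated`, the split `S` with `hβ`, **THE WALL
`hD : D1Drift Lc (JsBalAn1Ctr hLc cE cVH cΛ cE₂ cB T) N μ ν`**, (D4) STRICT, (C), `0 < γ₀`, run-side ⟹ `EndpointExistence Cn ∧ …`.  NO root, NO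
table hypothesis among the binders.  Discharges nothing of `BetaPertH`.  Our own derived statement. -/
theorem wallEND_of_D1Drift_JsBalAn1Ctr_cont_allProfiles {Cn : B12.Construction} (hgen : ForwardGenerated Cn β)
    (hhalt : HaltsOutside Cn β) (hcur : CurriesHBeta Cn β) (S : B12Beta.OneLoopSplit β) {N : ℝ} {μ ν : Fin 4}
    (hβ : ∀ j, S.β0 j = secondMoment (TbalOf Lc (JsBalAn1Ctr hLc cE cVH cΛ cE₂ cB T) j) μ ν)
    (hD : D1Drift Lc (JsBalAn1Ctr hLc cE cVH cΛ cE₂ cB T) N μ ν) {γ₀ r' β₀ : ℝ}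
    (hγ₀ : 0 < γ₀) (hrem : RemainderConst S γ₀ r') (hr' : r' < B12Normalization.stepBal N Lc) (hcont : BetaContH γ₀ β)
    (hβ₀ : 0 < β₀) {L : ℕ} (hL2 : 2 ≤ L) (p : ℕ) {κ₀ : ℕ} (hκ : 6 ≤ κ₀) :
    EndpointExistence Cn ∧ ∃ A : ℝ, ∃ γ₁ : ℝ, 0 < γ₁ ∧
      ∀ γ : ℝ, 0 < γ → γ ≤ min γ₀ γ₁ → ∀ Pr : B12.RunParams, (Cn Pr).flow.InInterval γ Pr.K →
        ∀ p' : ℕ, p' ≤ p → ∀ A₀ : ℝ, 0 ≤ A₀ →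
          ∃ Rj : ℕ → ℕ, (∀ j, B14.IsRj L p' ((Cn Pr).flow.g j) (Rj j)) ∧
            HorizonFacts (Cn Pr).flow (B12Normalization.stepBal N Lc + 2 * A + r') β₀ A₀ L p' κ₀ Rj Pr.K :=
  wallEND_of_D1Drift_JsBalAn1_cont_allProfiles hLc (ctrOff_mem_box hLc) cE cVH cΛ cE₂ cB T hgen hhalt hcur S hβ hD hγ₀ hrem hr'
    hcont hβ₀ hL2 p hκ

/-- **THE MINIMAL [III] CARRIER OVER THE CENTRED PLUGGED-IN FAMILY**: the wall + `hβ` + (D4) ⟹ `∃ A, BetaAvgAFH (stepBal N Lc − r') (2A) γ β`.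
Our own derived statement. -/
theorem betaAvgAFH_of_D1Drift_JsBalAn1Ctr (S : B12Beta.OneLoopSplit β) {N : ℝ} {μ ν : Fin 4}
    (hβ : ∀ j, S.β0 j = secondMoment (TbalOf Lc (JsBalAn1Ctr hLc cE cVH cΛ cE₂ cB T) j) μ ν)
    (hD : D1Drift Lc (JsBalAn1Ctr hLc cE cVH cΛ cE₂ cB T) N μ ν) {γ r' : ℝ} (hrem : RemainderConst S γ r') :
    ∃ A : ℝ, BetaAvgAFH (B12Normalization.stepBal N Lc - r') (2 * A) γ β :=
  betaAvgAFH_of_D1Drift_JsBalAn1 hLc (ctrOff_mem_box hLc) cE cVH cΛ cE₂ cB T S hβ hD hrem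

end Centred

end Summit.QuantumFields.BalabanUV.Beta.AveragedAFCarrierJsBalAn1

end
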